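import Literature.AlgebraicGeometry.HodgeTheory.AbelianVarietyUniformisationPicardConverse
import Literature.AlgebraicGeometry.HodgeTheory.AbelianVarietyBettiFormsComparisonDeRham
import Literature.AlgebraicGeometry.HodgeTheory.ComplexTorusIntegrationFamilyRational
import Literature.AlgebraicGeometry.HodgeTheory.CartierDivisorChernClass
import Literature.AlgebraicGeometry.HodgeTheory.ChernCharacterClass
import Literature.AlgebraicGeometry.HodgeTheory.HodgeStructureOfHodgeModel
import Literature.Geometry.Kaehler.ComplexTorusChernFormAppellHumbert
import Literature.Geometry.Kaehler.ChernCharacterCocycleIso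

/-!
# The Chern character of `𝒪_A(Θ)^an` on a uniformised abelian variety is the Néron–Severi form

Layer `Literature/AlgebraicGeometry/HodgeTheory`; cell `hodgecm-mathlib`, rung B-I/(U), leaf (T3) of the engine
«the polarisation Gram is flat in a flat integral frame» (node U-e of the Siegel period map).

Let `A/ℂ` be an abelian variety analytified by the complex torus `X = E/Φ(ℤ^ι)` (`φ : X → A(ℂ)`,
`IsAnalytification E A.X A.dim φ`), `Θ` a Cartier divisor on `A` and `(H, χ)` THE Appell–Humbert datum of the
holomorphic line bundle `𝒪_A(Θ)^an = cartierDivisorLineBundle hφ Θ` on `X` (`AHData.toPic p = picClass 𝒪_A(Θ)^an`,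
Appell–Humbert, [Lange2023] Thm. 1.3.3), `E = Im H` (`p.form`).  Lange, Lemma 1.3.1 (ii) / Lemma 2.1.2 / Thm. 2.1.3:
«`c₁(L(H, χ)) = H`», i.e. the first Chern class of `L(H, χ)` is the invariant integral `2`-form `E` under
`H²(X, ℤ) = Alt²(Λ, ℤ)`.  This file reads that sentence for the ALGEBRAIC line bundle `𝒪_A(Θ)` in the tree's
Chern–Weil currency (`SmoothComplexVectorBundle.chernCharacterDeRham`, `HodgeModel.chernCharacter`) and in the de Rham
isomorphism OF RECORD `e₀ = (integrationDeRhamIsoFamily E).complexify` (integration of forms over smooth simplices,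
`∫_{λᵢ} dxⱼ = δᵢⱼ`, [Lange2023] Prop. 1.1.20), where every comparison is exact — no undetermined scalar:

* §1 (de Rham level, comparison-free) `chernCharacterDeRham_cartierDivisorCocycle_eq_cconstClass`:
  `ch₁(𝒪_A(Θ)^an) = [ω_{-E}] ∈ H²_dR(X; ℂ)`, the class of the translation-invariant form `constForm Φ (-(E ⊗ 1))`
  (tree sign of `IsChernForm`, row A4-16 `isChernForm_ahMetric`).  Proof: `𝒪_A(Θ)^an` and `L(H, χ)` have the same
  class in `Pic(X)`, hence holomorphically isomorphic cocycles (`analyticallyEquivalent_of_picClass_eq`), hence the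
  same Chern–Weil classes (`CocycleIso.chernCharacterDeRham_eq`); and the Chern form of Lange's metric `e(-π H)` on
  `L(H, χ)` is `-E` (`isChernForm_ahMetric`, `chernCharacterDeRham_eq_mk`).
* §2 (singular level, any finite index type `ι`) `chernCharacter_cartierDivisorCocycle_integrationFamily`:
  `ch₁^{e₀}(𝒪_A(Θ)^an) = -(φ^* (E₂⁻¹ (E ⊗ 1))) ⊗ 1 ∈ H²(X; ℂ)`, where
  `E₂ = bettiFormsEquivDeg Φ A φ hφ 2 : H²(A(ℂ); ℚ) ≃ H²(X, ℚ)_forms` is the cup-algebraic Betti–forms comparison of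
  row A1-30 (`AbelianVarietyBettiFormsComparisonDeRham`: `e₀,X[γ] = φ^*(E_k⁻¹ γ) ⊗ 1`); and the same read in
  `H²(A(ℂ); ℂ)`: `map_neg_ofRatClass_bettiFormsEquivDeg_symm_eq_chernCharacter` and, for the torus Hodge model
  of record `(E, X, φ, e₀)`, `chernCharacter_cartierDivisorCocycle_hodgeModel_of_record`:
  `ch₁(𝒪_A(Θ)) = -(E₂⁻¹(E ⊗ 1)) ⊗ 1`.

Theorems only; no definition, no named fact.  HC_CM bookkeeping: consumed by the (N3-core) glue of the cell's
U-e node together with the topological leaf (T2) and the base-point Gram (G₀).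

## References

* [Lange2023AbelianVarietiesComplex] H. Lange, *Abelian Varieties over the Complex Numbers* (2023), §1.3.1
  Lemma 1.3.1, §1.3.2 Thm. 1.3.3, §2.1.2 Lemma 2.1.2 and Thm. 2.1.3, §1.1.4 Prop. 1.1.20.
* [VoisinHodgeI2002] C. Voisin, *Hodge Theory and Complex Algebraic Geometry I* (2002), §3.3.1, Thm. 7.10, §11.1.2.
* [Kobayashi1987] S. Kobayashi, *Differential Geometry of Complex Vector Bundles* (1987), Ch. II §1 Axiom 2,
  §2 Thm. 2.16.
* [SerreGAGA1956] J.-P. Serre, *Géométrie algébrique et géométrie analytique* (1956), §3 n°9.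
-/

noncomputable section

-- `ComplexTorus Φ` unfolds to `ι → AddCircle 1`; instance paths up to unfolding (as in row A1-30⁺⁺)
set_option backward.isDefEq.respectTransparency false

open scoped Manifold ContDiff
open Literature.NumberTheory.Transcendental Literature.Geometry.Kaehler
open Literature.AlgebraicTopology.SingularHomology
open Literature.AlgebraicGeometry.Motives (ComplexPoints AbelianVariety CartierDivisor SchemeOver)

namespace Literature.AlgebraicGeometry.HodgeTheory

/-! ### §1 De Rham level: `ch₁(𝒪_A(Θ)^an) = [-E]` -/

section DeRham

variable {ι : Type} [Fintype ι] {E : Type} [NormedAddCommGroup E] [NormedSpace ℂ E] [FiniteDimensional ℂ E]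
  (Φ : (ι → ℝ) ≃L[ℝ] E) {n : ℕ} {X : SchemeOver ℂ} [AlgebraicGeometry.IsIntegral X.left]
  {φ : ComplexTorus Φ → ComplexPoints X} (hφ : IsAnalytification E X n φ)

/-- **`ch₁(L(H, χ)) = [-E]` in `H²_dR(X; ℂ)`** (Lange, Lemma 1.3.1 (ii) «`c₁(L(H, χ)) = H`», tree sign): the
first Chern–Weil class of the cocycle of `L(H, χ) = p.lineBundle` is the class of the invariant form
`constForm Φ (-(E ⊗ 1))` — the Chern form of Lange's metric `e(-π H)` (`isChernForm_ahMetric`), any connection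
computing `ch₁` (`chernCharacterDeRham_eq_mk`, Chern–Weil II). [cite: Lange2023AbelianVarietiesComplex, §1.3.1 Lemma 1.3.1]
[cite: Kobayashi1987, Ch. II §2 Thm. 2.16] -/
theorem chernCharacterDeRham_lineBundle_ahData (p : ComplexTorus.AHData Φ) :
    p.lineBundle.toSmoothCocycle.chernCharacterDeRham 1 =
      ComplexTorus.cconstClass Φ (-ComplexTorus.ofRealForm p.form) := by
  rw [ComplexTorus.cconstClass_apply]
  exact SmoothComplexVectorBundle.chernCharacterDeRham_eq_mk
    (SmoothComplexVectorBundle.mk_eq_mk_of_isChernCharacterForm_holds E (ComplexTorus Φ))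
    (ComplexTorus.ahMetric p.isNSForm_form p.isSemicharacter_char).chernConnection
    (ComplexTorus.isSmoothForm_constForm Φ _) (ComplexTorus.isClosedForm_constForm Φ _)
    ((ComplexTorus.ahMetric p.isNSForm_form p.isSemicharacter_char).isChernCharacterForm_of_isChernForm
      (ComplexTorus.isChernForm_ahMetric p.isNSForm_form p.isSemicharacter_char))

/-- **`𝒪_X(Θ)^an ≅ L(H, χ)` as holomorphic cocycles** for the Appell–Humbert datum `p = (H, χ)` of `𝒪_X(Θ)^an`
(`AHData.toPic p = picClass 𝒪_X(Θ)^an`): both have the class `⟦a_{(H,χ)}⟧ ∈ Pic(X)` (`picClass_lineBundle`), and line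
bundles with the same class have holomorphically isomorphic cocycles (`analyticallyEquivalent_of_picClass_eq`).
[cite: Lange2023AbelianVarietiesComplex, §1.2.1 Prop. 1.2.2 and §1.3.2 Thm. 1.3.3] -/
theorem analyticallyEquivalent_cartierDivisorCocycle_lineBundle_ahData (Θ : CartierDivisor X.left)
    (p : ComplexTorus.AHData Φ)
    (hp : ComplexTorus.AHData.toPic p = ComplexTorus.picClass (cartierDivisorLineBundle hφ Θ)) :
    (cartierDivisorCocycle hφ Θ).AnalyticallyEquivalent p.lineBundle.toSmoothCocycle := by
  rw [← cartierDivisorLineBundle_toSmoothCocycle hφ Θ]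
  refine analyticallyEquivalent_of_picClass_eq ?_
  rw [← hp, ComplexTorus.AHData.lineBundle_eq, ComplexTorus.picClass_lineBundle, ComplexTorus.AHData.toPic_apply]

/-- **(T3, de Rham level) `ch₁(𝒪_X(Θ)^an) = [-E]`** for every integral `X/ℂ` analytified by the complex torus
`E/Φ(ℤ^ι)`, every Cartier divisor `Θ` and the Appell–Humbert datum `p = (H, χ)` of `𝒪_X(Θ)^an` (`E = Im H = p.form`):
the first Chern–Weil class of the cocycle `𝒪_X(Θ)^an` is the class of the invariant form `-(E ⊗ 1)` (Lange,
Lemma 2.1.2 / Lemma 1.3.1 (ii) for the algebraic line bundle; isomorphic cocycles have equal Chern–Weil classes,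
Kobayashi II §1 Axiom 2). [cite: Lange2023AbelianVarietiesComplex, §2.1.2 Lemma 2.1.2 and §1.3.1 Lemma 1.3.1]
[cite: Kobayashi1987, Ch. II §1 Axiom 2 and §2 Thm. 2.16] -/
theorem chernCharacterDeRham_cartierDivisorCocycle_eq_cconstClass (Θ : CartierDivisor X.left)
    (p : ComplexTorus.AHData Φ)
    (hp : ComplexTorus.AHData.toPic p = ComplexTorus.picClass (cartierDivisorLineBundle hφ Θ)) :
    (cartierDivisorCocycle hφ Θ).chernCharacterDeRham 1 =
      ComplexTorus.cconstClass Φ (-ComplexTorus.ofRealForm p.form) := by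
  obtain ⟨Ψ, hΨ⟩ := analyticallyEquivalent_cartierDivisorCocycle_lineBundle_ahData Φ hφ Θ p hp
  rw [Ψ.chernCharacterDeRham_eq
      (SmoothComplexVectorBundle.mk_eq_mk_of_isChernCharacterForm_holds E (ComplexTorus Φ)) hΨ.isSmooth 1,
    chernCharacterDeRham_lineBundle_ahData]

/-- The same through any complex de Rham comparison family `e` (`SmoothComplexVectorBundle.chernCharacter`):
`ch₁^e(𝒪_X(Θ)^an) = -e_X[E ⊗ 1] ∈ H²(X; ℂ)`. [cite: Lange2023AbelianVarietiesComplex, §2.1.2 Lemma 2.1.2]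
[cite: Kobayashi1987, Ch. II §2 Thm. 2.16] -/
theorem chernCharacter_cartierDivisorCocycle_eq_neg_apply_cconstClass (e : ComplexDeRhamIsoFamily E)
    (Θ : CartierDivisor X.left) (p : ComplexTorus.AHData Φ)
    (hp : ComplexTorus.AHData.toPic p = ComplexTorus.picClass (cartierDivisorLineBundle hφ Θ)) :
    (cartierDivisorCocycle hφ Θ).chernCharacter e 1 =
      -e (ComplexTorus Φ) 2 (ComplexTorus.cconstClass Φ (ComplexTorus.ofRealForm p.form)) := by
  rw [SmoothComplexVectorBundle.chernCharacter_def, chernCharacterDeRham_cartierDivisorCocycle_eq_cconstClass Φ hφ Θ p hp,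
    map_neg]
  exact map_neg (e (ComplexTorus Φ) (2 * 1)) _

end DeRham

/-! ### §2 Singular level in the de Rham isomorphism of record: `ch₁^{e₀}(𝒪_A(Θ)^an) = -(φ^* E₂⁻¹(E)) ⊗ 1` -/

section Record

variable {ι : Type} [Fintype ι] {E : Type} [NormedAddCommGroup E] [NormedSpace ℂ E]
  [FiniteDimensional ℝ E] [FiniteDimensional ℂ E] (Φ : (ι → ℝ) ≃L[ℝ] E) (A : AbelianVariety ℂ)
  (φ : C(ComplexTorus Φ, ComplexPoints A.X)) (hφ : IsAnalytification E A.X A.dim φ)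

omit [Fintype ι] [FiniteDimensional ℝ E] [FiniteDimensional ℂ E] in
/-- The Néron–Severi form `E ⊗ 1` of an Appell–Humbert datum is a rational (indeed integral) invariant `2`-form:
the element `⟨E ⊗ 1, _⟩ ∈ H²(X, ℚ)_forms`. [cite: Lange2023AbelianVarietiesComplex, §1.3.1 (1.10)] -/
theorem ofRealForm_form_mem_rationalForms (p : ComplexTorus.AHData Φ) :
    ComplexTorus.ofRealForm p.form ∈ ComplexTorus.rationalForms Φ 2 :=
  ComplexTorus.mem_rationalForms_of_mem_integralForms Φ (ComplexTorus.ofRealForm_mem_integralForms_two Φ p.isNSForm_form)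

/-- **(T3, singular level) `ch₁^{e₀}(𝒪_A(Θ)^an) = -(φ^*(E₂⁻¹(E ⊗ 1))) ⊗ 1` in `H²(X; ℂ)`** — EXACT, for the de Rham
isomorphism of record `e₀ = (integrationDeRhamIsoFamily E).complexify` and the cup-algebraic Betti–forms comparison
`E₂ = bettiFormsEquivDeg Φ A φ hφ 2 : H²(A(ℂ); ℚ) ≃ H²(X, ℚ)_forms` (Lange, Prop. 1.1.20: «the cup product corresponds under
the de Rham isomorphism to the exterior product», `complexify_cconstClass_eq_ringChange_map_bettiFormsEquivDeg_symm`), on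
ANY finite index type `ι`. [cite: Lange2023AbelianVarietiesComplex, §2.1.2 Lemma 2.1.2 and §1.1.4 Prop. 1.1.20]
[cite: Kobayashi1987, Ch. II §2 Thm. 2.16] -/
theorem chernCharacter_cartierDivisorCocycle_integrationFamily (Θ : CartierDivisor A.X.left)
    (p : ComplexTorus.AHData Φ)
    (hp : ComplexTorus.AHData.toPic p = ComplexTorus.picClass (cartierDivisorLineBundle hφ Θ)) :
    (cartierDivisorCocycle hφ Θ).chernCharacter (integrationDeRhamIsoFamily E).complexify 1 =
      -singularCohomology.ringChange (algebraMap ℚ ℂ) (ComplexTorus Φ) 2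
        (singularCohomology.map ℚ ℚ φ 2
          ((bettiFormsEquivDeg Φ A φ hφ 2).symm
            ⟨ComplexTorus.ofRealForm p.form, ofRealForm_form_mem_rationalForms Φ p⟩)) := by
  rw [chernCharacter_cartierDivisorCocycle_eq_neg_apply_cconstClass Φ hφ _ Θ p hp,
    ← complexify_cconstClass_eq_ringChange_map_bettiFormsEquivDeg_symm Φ A φ hφ
      ⟨ComplexTorus.ofRealForm p.form, ofRealForm_form_mem_rationalForms Φ p⟩]

/-- **The same in `H²(A(ℂ); ℂ)`**: the complexified rational class `-(E₂⁻¹(E ⊗ 1)) ⊗ 1` pulls back along `φ` to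
`ch₁^{e₀}(𝒪_A(Θ)^an)` (change of coefficients commutes with `φ^*`). [cite: Lange2023AbelianVarietiesComplex, §2.1.2 Lemma 2.1.2]
[cite: HatcherAT2002, §3.1 p. 198] -/
theorem map_neg_ofRatClass_bettiFormsEquivDeg_symm_eq_chernCharacter (Θ : CartierDivisor A.X.left)
    (p : ComplexTorus.AHData Φ)
    (hp : ComplexTorus.AHData.toPic p = ComplexTorus.picClass (cartierDivisorLineBundle hφ Θ)) :
    singularCohomology.map ℂ ℂ φ 2
        (-ofRatClass (ComplexPoints A.X) 2
          ((bettiFormsEquivDeg Φ A φ hφ 2).symm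
            ⟨ComplexTorus.ofRealForm p.form, ofRealForm_form_mem_rationalForms Φ p⟩)) =
      (cartierDivisorCocycle hφ Θ).chernCharacter (integrationDeRhamIsoFamily E).complexify 1 := by
  rw [map_neg, ofRatClass_eq_ringChange, ← singularCohomology.ringChange_map,
    chernCharacter_cartierDivisorCocycle_integrationFamily Φ A φ hφ Θ p hp]

/-- **(T3, Hodge-model level) for the torus Hodge model OF RECORD `B₀ = (E, X, φ, e₀)` of `A`:**
`B₀.chernCharacter 𝒪_A(Θ)^an 1 = -(E₂⁻¹(E ⊗ 1)) ⊗ 1 ∈ H²(A(ℂ); ℂ)` — the first Chern character class of the Cartier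
divisor `Θ` is (minus, tree sign) the complexification of the RATIONAL Betti class whose invariant form is the
Néron–Severi form `E = Im H` of `𝒪_A(Θ)^an` (Lange, Thm. 2.1.3 / Lemma 2.1.2, read through `φ`).
[cite: Lange2023AbelianVarietiesComplex, §2.1.2 Lemma 2.1.2 and Thm. 2.1.3] [cite: Kobayashi1987, Ch. II §2 Thm. 2.16] -/
theorem chernCharacter_cartierDivisorCocycle_hodgeModel_of_record (Θ : CartierDivisor A.X.left)
    (p : ComplexTorus.AHData Φ)
    (hp : ComplexTorus.AHData.toPic p = ComplexTorus.picClass (cartierDivisorLineBundle hφ Θ)) :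
    ({ model := E, carrier := ComplexTorus Φ, toComplexPoints := φ, isAnalytification := hφ,
        deRham := (integrationDeRhamIsoFamily E).complexify, deRham_isNatural := integrationFamily_isNatural,
        isInternal_hodgePQ := ComplexTorus.isInternal_hodgePQ Φ } : HodgeModel A.dim A.X).chernCharacter
        (cartierDivisorCocycle hφ Θ) 1 =
      -ofRatClass (ComplexPoints A.X) 2
        ((bettiFormsEquivDeg Φ A φ hφ 2).symm
          ⟨ComplexTorus.ofRealForm p.form, ofRealForm_form_mem_rationalForms Φ p⟩) := by
  set B₀ : HodgeModel A.dim A.X :=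
    { model := E, carrier := ComplexTorus Φ, toComplexPoints := φ, isAnalytification := hφ,
      deRham := (integrationDeRhamIsoFamily E).complexify, deRham_isNatural := integrationFamily_isNatural,
      isInternal_hodgePQ := ComplexTorus.isInternal_hodgePQ Φ }
  apply B₀.pullback_injective (2 * 1)
  rw [B₀.pullback_chernCharacter_eq_chernCharacter]
  have hφc : (⟨φ, hφ.isHomeomorph.continuous⟩ : C(ComplexTorus Φ, ComplexPoints A.X)) = φ :=
    ContinuousMap.ext fun _ ↦ rfl
  change _ = singularCohomology.map ℂ ℂ ⟨φ, hφ.isHomeomorph.continuous⟩ 2 _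
  rw [hφc, map_neg_ofRatClass_bettiFormsEquivDeg_symm_eq_chernCharacter Φ A φ hφ Θ p hp]

end Record

end Literature.AlgebraicGeometry.HodgeTheory

end
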